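import Literature.NumberTheory.EllipticCurves.BSDSelmer
import Literature.NumberTheory.DiophantineGeometry.Conductor
import HarnessLib

/-!
# `Ш(E/ℚ)[p] = 0` for curves of rank `≥ 2` — the Stein–Wuthrich table (Math. Comp. 82 (2013), Thm. 1.1)

A NAMED FACT (computer-assisted theorem in print, no `_holds` here): W. Stein and C. Wuthrich,
*Algorithms for the arithmetic of elliptic curves using Iwasawa theory*, Math. Comp. 82 (2013) 1757–1792,
**Theorem 1.1** (p. 1758): «Let `X` be the set of 1 534 422 pairs `(E, p)`, where `E` is a non-CM elliptic
curve over `ℚ` with rank at least `2` and conductor `≤ 30 000`, and `p ≥ 5` is a good ordinary prime for `E`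
with `p < 1000` such that the mod `p` representation is surjective. Then `Ш(E/ℚ)[p] = 0` for each of the pairs
in `X`.» Proof in print (§12.4, p. 1787; Algorithm 11.1, p. 1783): for each pair the modular-symbol `p`-adic
`L`-series has `ord_T L_p(E,T) = rank E(ℚ)`, the `p`-adic regulator is non-zero, and the order of `Ш` predicted
by the `p`-adic Birch–Swinnerton-Dyer formula is `1 + O(p)`; Kato's divisibility `char(X(E/ℚ_∞)) ∣ L_p(E,T)`
(Thm. 7.3 there, integral because `ρ̄_{E,p}` is onto) then gives `#Ш(E/ℚ)(p) ∣ p^0`, unconditionally.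

Why it is vendored: the depth table of route `KolyvaginDepthDoor` (crux `KolyvaginDepthSupplyKN`) reads each of
its eighteen rank-two rows as «one Kolyvagin bit ⟺ `Ш(E/ℚ)[p] = 0` ∧ (a `p`-Selmer bound on ONE rank-one
Heegner twist)»; for all eighteen curves (`N ≤ 1000`, `p ∈ {5, 7}`, `ρ̄` onto, rank `2`) the first conjunct is
an instance of this theorem, so the rows become statements about ONE rank-one curve.

Tree vocabulary: `E` is a globally minimal model (the paper's (1.1)), «rank» = `mordellWeilRank`, «conductor»
= `conductorNorm ℤ`, «good ordinary at `p`» = `HasGoodReductionAtPrime p ∧ ¬ p ∣ a_p` (`frobeniusTrace`),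
«mod `p` representation surjective» = `HasSurjectiveModNGaloisRep p`, «`Ш(E/ℚ)[p] = 0`» =
`Ш ⊓ H¹(ℚ,E)[p] = ⊥` (the spelling of `BSDSelmer` / the depth table). Deliberately NOT here: Theorem 12.3 of
the same paper (`389a`, all good ordinary `p < 48 859` but `16 231`), the rank-`≤ 1` companions (§§8–9), and
any `_holds` (the proof is a months-long machine computation resting on Kato 2004 Thm. 17.4).

References: [SteinWuthrich2013] W. Stein, C. Wuthrich, Math. Comp. 82 (2013), Thm. 1.1, §11 (Algorithm 11.1),
§12.4; K. Kato, Astérisque 295 (2004), Thm. 17.4 (the divisibility used in their Thm. 7.3).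
-/

namespace Literature.NumberTheory.EllipticCurves

open WeierstrassCurve

/-- **Stein–Wuthrich 2013, Theorem 1.1** (computer-assisted theorem in print; named fact, not discharged
here). For every non-CM elliptic curve `E/ℚ` (globally minimal model `W`) of Mordell–Weil rank `≥ 2` and
conductor `N_E ≤ 30 000`, and every prime `5 ≤ p < 1000` of good ordinary reduction with `ρ̄_{E,p}`
surjective: `Ш(E/ℚ)[p] = 0`, written as `Ш ⊓ H¹(ℚ,E)[p] = ⊥`. («Let `X` be the set of 1 534 422 pairs `(E, p)`,
where `E` is a non-CM elliptic curve over `ℚ` with rank at least `2` and conductor `≤ 30 000`, and `p ≥ 5` is a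
good ordinary prime for `E` with `p < 1000` such that the mod `p` representation is surjective. Then
`Ш(E/ℚ)[p] = 0` for each of the pairs in `X`.» — proved in §12.4 via Algorithm 11.1: `ord_T L_p = r`, `Reg_p ≠ 0`,
predicted `#Ш ≡ 1 (mod p)`, and Kato's integral divisibility.)
[cite: SteinWuthrich2013, Thm. 1.1 (p. 1758); proof §12.4 (p. 1787), Algorithm 11.1 (p. 1783)] -/
def SteinWuthrich2013_sha_inf_torsionBy_eq_bot_of_two_le_rank : Prop :=
  ∀ (W : WeierstrassCurve ℚ) [W.IsElliptic] [W.IsGloballyMinimal], ¬ W.HasCM → 2 ≤ W.mordellWeilRank →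
    W.conductorNorm ℤ ≤ 30000 → ∀ (p : ℕ) [Fact p.Prime], 5 ≤ p → p < 1000 →
    W.HasGoodReductionAtPrime p → ¬ (p : ℤ) ∣ W.frobeniusTrace p → W.HasSurjectiveModNGaloisRep p →
    (W.sha ⊓ AddSubgroup.torsionBy W.galH1 (p : ℤ) : AddSubgroup W.galH1) = ⊥

end Literature.NumberTheory.EllipticCurves
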